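import Summits.BirchSwinnertonDyer.BirchSwinnertonDyer.Theorems.GenusKolyvaginAtTwoPowDvdShaCardAtTwoRTTwinShaLaddersFinal
import Summits.BirchSwinnertonDyer.BirchSwinnertonDyer.Theorems.CMKolyvaginAtInertTwoLowerRungSupplyAtTwo
import Summits.BirchSwinnertonDyer.BirchSwinnertonDyer.Theorems.CMKolyvaginAtInertTwoShaCountRankFiniteAtTwo
import HarnessLib

/-!
# Route `CMKolyvaginAtInertTwo`, crux `CMKolyvaginExactAtInertTwo` (stmt-BirchSwinnertonDyer-24277), `stub_lower` —
# PORT OF gk2's LINE 18, FILE B4: THE DESCENT-LAYER CAPSTONE (the two ℚ-side Ш-ladders from Kolyvagin's minima with Prop. 5.2 at `2`)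
# WITHOUT THE IMAGE BINDERS, and `rank E(K) = 1` from the route's published inputs

Seat `bsd-line-cmk2-p1` g19 (cell `bsd-print-cf2`), `--supports stmt-BirchSwinnertonDyer-24277` (helper; closes nothing).
THEOREMS ONLY (no definition, no named fact, no `sorry`).  BSD is NOT proved by any of this; the crux is not closed here.

WHAT.  gk2-p2 g18's capstone `PlusDescent.twinShaLadders_of_kolyvaginSuppliesAtTwo(')` (`…RTTwinShaLaddersOfKolyvaginSupplies`,
`…RTTwinShaLaddersFinal`): from Kolyvagin's minima with McCallum's Prop. 5.2 at `2` (hypothesis `hKS`) to the two Ш-ladders of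
`stub_twinShaLaddersAtTwo`.  Its binders `¬ W.HasCM`, `ρ_{E,2^∞}` onto, Q2, `PubInputsAtTwo` enter only through (a) the rung supply
(`avoidance_of_kolyvaginSupply_intrinsic` → file A `CMKolyvaginAtInertTwoLowerRungSupplyAtTwo`, from `ρ̄_{E,2}` onto + Gross 1991
Prop. 3.7 (2) at `(W, K)` by name) and (b) Kolyvagin's `rank E(K) = 1` (the `.kolyvagin` conjunct of `PubInputsAtTwo`), here DISPLAYED as
`hrk1` and, in `mordellWeilRank_baseChange_eq_one_of_facts`, derived on the route's own published inputs GZ (24148) / GZK (19921) /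
modularity (19273) exactly as g15's `ShaCountTwo.rank_add_eq_one_and_finite_sha_of_heegnerData_of_facts`.  Everything else (gk2-p2's frame
`exists_Kside_frame`, `twinShaLadders_of_depth_supplies`, `rankZero_side_of_rootNumber`) is image-free and used by name.  Proofs =
gk2-p2's VERBATIM with those two substitutions (credit gk2-p2 g18).  Holds for every `W/ℚ` with `ρ̄_{E,2}` onto, in particular on H₂.

References: [McCallumLMS1991] §5 p. 285, Prop. 5.2, Thm. 5.4 (p. 310); [GrossLMS1991] Thm. 1.3, Prop. 3.7 (2), §4 (4.1), (4.4), Prop. 5.3–5.4,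
Prop. 6.2; [GrossZagier1986] Thm. I.6.3; [Kolyvagin1990] Thm. A.
-/

set_option autoImplicit false
-- the Theorems namespace of this sub repeats the summit name by design (D-0017 nested layout)
set_option linter.dupNamespace false

noncomputable section

open scoped Classical

namespace Summit.BirchSwinnertonDyer.BirchSwinnertonDyer.Theorems.KolyvaginLowerTwo

open WeierstrassCurve NumberField IsDedekindDomain Field Literature.NumberTheory.EllipticCurves
  Literature.NumberTheory.GaloisRepresentations Literature.NumberTheory.EllipticCurves.ModularForms AddSubgroup
open Literature.NumberTheory.EllipticCurves.GrossLMS1991 (prop37_2_reductionCongruence_inert)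
open Summit.BirchSwinnertonDyer.BirchSwinnertonDyer.Theorems.GenusExact
open Summit.BirchSwinnertonDyer.BirchSwinnertonDyer.Theorems.GenusExact.PlusDescent

/-! ## §0 `rank E(K) = 1` from the route's published inputs -/

/-- **`rank E(K) = 1` on the Heegner frame, from GZ / GZK / modularity** (the route's cite-level support items 24148, 19921, 19273): for
`W/ℚ` globally minimal, `K` imaginary quadratic with the Heegner hypothesis and `y_K = P(1)` of infinite order.  Proof: g15's
`ShaCountTwo.rank_add_eq_one_and_finite_sha_of_heegnerData_of_facts` (`rank W + rank W^{(d_K)} = 1`) and the quadratic base-change rank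
formula `mordellWeilRank_baseChange_quadratic_holds`.  CONDITIONAL on the three displayed print facts.
[cite: GrossZagier1986, Thm. I.6.3] [cite: Kolyvagin1990, Thm. A] [cite: GrossLMS1991, Thm. 1.3] -/
theorem mordellWeilRank_baseChange_eq_one_of_facts
    (hGZ : ∀ (N : ℕ) [NeZero N] (W : WeierstrassCurve ℚ) (K : Type) [Field K] [NumberField K], gross_zagier N W K)
    (hGZK : rank_eq_analyticRank_of_analyticRank_le_one) (hmod : hasEntireLFunction_rat)
    (W : WeierstrassCurve ℚ) [W.IsElliptic] [W.IsGloballyMinimal] [NeZero (W.conductorNorm ℤ)]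
    (K : Type) [Field K] [NumberField K] (hK : IsImaginaryQuadratic K)
    (hH : SatisfiesHeegnerHypothesis (W.conductorNorm ℤ) K)
    (Dt : ModularParametrizationData W (W.conductorNorm ℤ)) (β : ℤ) (ι : K →+* ℂ)
    (d₁ : KolyvaginHeegnerData Dt β ι 1) (hy : ¬ IsOfFinAddOrder d₁.derivedPoint) :
    (W.baseChange K).mordellWeilRank = 1 := by
  have h2 : Module.finrank ℚ K = 2 := hK.1
  have hD0 : (NumberField.discr K : ℚ) ≠ 0 := by exact_mod_cast NumberField.discr_ne_zero K
  haveI hEt : (W.quadraticTwist (NumberField.discr K : ℚ)).IsElliptic := W.isElliptic_quadraticTwist hD0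
  obtain ⟨hsum, -, -⟩ := ShaCountTwo.rank_add_eq_one_and_finite_sha_of_heegnerData_of_facts hGZ hGZK hmod W K hK hH Dt β ι d₁ hy
    (W.quadraticTwist (NumberField.discr K : ℚ)) ⟨1, one_smul _ _⟩
  rw [mordellWeilRank_baseChange_quadratic_holds W K h2, hsum]

/-! ## §1 The capstone modulo (R0) + (KS) -/

/-- **gk2's STUB L CONCLUSION (the two ℚ-side Ш-ladders) MODULO (R0) + (KS), WITHOUT the non-CM / full-image binders** — gk2-p2 g18's
`PlusDescent.twinShaLadders_of_kolyvaginSuppliesAtTwo` with `rank E(K) = 1` DISPLAYED (`hrk1`, in place of the `PubInputsAtTwo` conjunct; `y_K`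
non-torsion is then not needed), and `ρ̄_{E,2}` onto + Gross 1991 Prop. 3.7 (2) at `(W, K)` in place of the route decl Q2 and the image
binders; proof verbatim over file A's rung supply (credit gk2-p2 g18).  The displayed hypothesis `hKS` is, per depth with a positive drop of the
minima `Mr`, McCallum's Prop. 5.2 at `2` for Kolyvagin's classes (see gk2-p2's docstring). [cite: McCallumLMS1991, §5 Prop. 5.2, Thm. 5.4 (p. 310)]
[cite: GrossLMS1991, Thm. 1.3, Prop. 5.4, Prop. 6.2] -/
theorem twinShaLadders_of_kolyvaginSuppliesAtTwo
    (W : WeierstrassCurve ℚ) [W.IsElliptic] [W.IsGloballyMinimal] [NeZero (W.conductorNorm ℤ)] (hρ2 : W.HasSurjectiveModNGaloisRep 2)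
    (hT : Odd W.tamagawaProduct) (K : Type) [Field K] [NumberField K] (hIQ : IsImaginaryQuadratic K)
    (hodd : Odd (NumberField.discr K)) (h3 : NumberField.discr K ≠ -3) (hHe : SatisfiesHeegnerHypothesis (W.conductorNorm ℤ) K)
    (h37 : prop37_2_reductionCongruence_inert (W.conductorNorm ℤ) W K)
    (Dt : ModularParametrizationData W (W.conductorNorm ℤ)) (β : ℤ) (ι : K →+* ℂ) (d₁ : KolyvaginHeegnerData Dt β ι 1)
    (hrk1 : (W.baseChange K).mordellWeilRank = 1) (M₀ : ℕ)
    (hndiv : ¬ ∃ Q : (W.baseChange (ringClassField K ι 1)).toAffine.Point, ((2 ^ (M₀ + 1) : ℕ) : ℤ) • Q = d₁.derivedPoint)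
    (Wd : WeierstrassCurve ℚ) [Wd.IsElliptic] (hTw : ∃ C : VariableChange ℚ, C • W.quadraticTwist (NumberField.discr K : ℚ) = Wd)
    (hR0 : (W.rootNumber = 1 ∧ W.mordellWeilRank = 0 ∧ Odd W.torsionOrder) ∨
      (W.rootNumber = -1 ∧ Wd.mordellWeilRank = 0 ∧ Odd Wd.torsionOrder))
    (hKS : ∀ τ : K ≃ₐ[ℚ] K, τ ≠ 1 → ∃ (L R : ℕ) (Mr : ℕ → ℕ), M₀ + 1 ≤ L ∧ (∀ j, Mr (j + 1) ≤ Mr j) ∧ Mr 0 = M₀ ∧ Mr R = 0 ∧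
      (∀ m : ℕ, Mr (2 * m + 1) < Mr (2 * m) →
        ∀ (i : ℕ) (u : Fin i → galH1Torsion (W.baseChange K) ((2 ^ L : ℕ) : ℤ)), i ≤ 2 * m + 1 →
        (∀ j, u j ∈ selmerGroup (W.baseChange K) ((2 ^ L : ℕ) : ℤ) ∧
          conjAct W τ ((2 ^ L : ℕ) : ℤ) (u j) = W.rootNumber • u j) →
        ∃ (n : ℕ) (_ : Squarefree n)
          (_ : ∀ ℓ ∈ n.primeFactors, Zhang2014.IsKolyvaginPrime (W.conductorNorm ℤ) W K 2 ℓ ∧ L ≤ Zhang2014.kolyvaginIndex W 2 ℓ)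
          (d : KolyvaginHeegnerData Dt β ι n),
          (∀ ℓ ∈ n.primeFactors, ∀ e : KolyvaginHeegnerData Dt β ι (n / ℓ),
            ((2 ^ (L - Mr (2 * m)) : ℕ) : ℤ) • e.kolyvaginClass Nat.prime_two L = 0) ∧
          addOrderOf (d.kolyvaginClass Nat.prime_two L) = 2 ^ (L - Mr (2 * m + 1)) ∧
          -W.rootNumber * (-1) ^ n.primeFactors.card = W.rootNumber ∧
          Disjoint (zmultiples (((2 ^ (L - Mr (2 * m)) : ℕ) : ℤ) • d.kolyvaginClass Nat.prime_two L))
            (AddSubgroup.closure (Set.range u))) ∧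
      (∀ m : ℕ, Mr (2 * m + 2) < Mr (2 * m + 1) →
        ∀ (i : ℕ) (u : Fin i → galH1Torsion (W.baseChange K) ((2 ^ L : ℕ) : ℤ)), i ≤ 2 * m + 1 →
        (∀ j, u j ∈ selmerGroup (W.baseChange K) ((2 ^ L : ℕ) : ℤ) ∧
          conjAct W τ ((2 ^ L : ℕ) : ℤ) (u j) = (-W.rootNumber) • u j) →
        ∃ (n : ℕ) (_ : Squarefree n)
          (_ : ∀ ℓ ∈ n.primeFactors, Zhang2014.IsKolyvaginPrime (W.conductorNorm ℤ) W K 2 ℓ ∧ L ≤ Zhang2014.kolyvaginIndex W 2 ℓ)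
          (d : KolyvaginHeegnerData Dt β ι n),
          (∀ ℓ ∈ n.primeFactors, ∀ e : KolyvaginHeegnerData Dt β ι (n / ℓ),
            ((2 ^ (L - Mr (2 * m + 1)) : ℕ) : ℤ) • e.kolyvaginClass Nat.prime_two L = 0) ∧
          addOrderOf (d.kolyvaginClass Nat.prime_two L) = 2 ^ (L - Mr (2 * m + 2)) ∧
          -W.rootNumber * (-1) ^ n.primeFactors.card = -W.rootNumber ∧
          Disjoint (zmultiples (((2 ^ (L - Mr (2 * m + 1)) : ℕ) : ℤ) • d.kolyvaginClass Nat.prime_two L))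
            (AddSubgroup.closure (Set.range u) ⊔ zmultiples (d₁.kolyvaginClass Nat.prime_two L)))) :
    ∃ (T : ℕ) (M : ℕ → ℕ), (∀ j, M (j + 1) ≤ M j) ∧ M 0 = M₀ ∧ M (2 * T) = 0 ∧
      (∀ m < T, ∃ x : Fin (2 * m + 2) → W.galH1, (∀ i, resBaseChange W K (x i) ∈ (W.baseChange K).sha) ∧
        (∀ i, addOrderOf (x i) = 2 ^ (M (2 * m) - M (2 * m + 1))) ∧
        ∀ c : Fin (2 * m + 2) → ℤ, ∑ i, c i • x i = 0 → ∀ i, ((2 ^ (M (2 * m) - M (2 * m + 1)) : ℕ) : ℤ) ∣ c i) ∧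
      (∀ m < T, ∃ x : Fin (2 * m + 2) → Wd.galH1, (∀ i, resBaseChange Wd K (x i) ∈ (Wd.baseChange K).sha) ∧
        (∀ i, addOrderOf (x i) = 2 ^ (M (2 * m + 1) - M (2 * m + 2))) ∧
        ∀ c : Fin (2 * m + 2) → ℤ, ∑ i, c i • x i = 0 → ∀ i, ((2 ^ (M (2 * m + 1) - M (2 * m + 2)) : ℕ) : ℤ) ∣ c i) := by
  have h2 : Module.finrank ℚ K = 2 := hIQ.1
  -- the conjugation of `K`
  obtain ⟨τ, -, hτ, -, -, -, -⟩ := exists_gal_ne_one_sqrt_discr (K := K) h2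
  obtain ⟨L, R, Mr, hML, hMr, hMr0, hMrR, hOdd, hEven⟩ := hKS τ hτ
  have hL1 : 1 ≤ L := by omega
  have hn : ((2 ^ L : ℕ) : ℤ) ≠ 0 := by positivity
  have hsurj1 : W.HasSurjectiveModNGaloisRep ((2 : ℤ) ^ 1) := by simpa using hρ2
  -- the frame at level `2^L`
  have hdiv : ∀ P : geomPoints (W.baseChange K), ∃ Q : geomPoints (W.baseChange K), ((2 ^ L : ℕ) : ℤ) • Q = P :=
    (W.baseChange K).zsmul_geomPoints_surjective_of_charZero hn
  obtain ⟨hL, g, P₀, hg, hP₀map, hP₀, hc1⟩ := exists_Kside_frame W Dt β ι hIQ hodd hHe hsurj1 hrk1.le d₁ hML hndiv hdiv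
  -- the antitone minima in the large
  have hanti : ∀ a b, a ≤ b → Mr b ≤ Mr a := fun a b hab ↦ by
    induction hab with
    | refl => exact le_rfl
    | step _ ih => exact (hMr _).trans ih
  have hMrL : ∀ j, Mr j ≤ L := fun j ↦ (hanti 0 j (Nat.zero_le j)).trans (by omega)
  -- (R0) in divisibility currency
  have hrank0 : (W.rootNumber = 1 ∧ ∀ P : W.toAffine.Point, ∃ Q : W.toAffine.Point, ((2 ^ L : ℕ) : ℤ) • Q = P) ∨
      (W.rootNumber = -1 ∧ ∀ P : Wd.toAffine.Point, ∃ Q : Wd.toAffine.Point, ((2 ^ L : ℕ) : ℤ) • Q = P) := by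
    rcases hR0 with ⟨hw, hrk, htor⟩ | ⟨hw, hrk, htor⟩
    · refine Or.inl ⟨hw, fun P ↦ ?_⟩
      convert exists_zsmul_two_pow_eq_of_rank_zero_of_odd_torsionOrder W hrk htor L P
    · refine Or.inr ⟨hw, fun P ↦ ?_⟩
      convert exists_zsmul_two_pow_eq_of_rank_zero_of_odd_torsionOrder Wd hrk htor L P
  refine twinShaLadders_of_depth_supplies W K h2 τ hτ L hdiv hL hTw hrank0 g hg P₀ hP₀ M₀ R Mr hMr hMr0 hMrR
    (fun m hlt i hi u hu hord ↦ ?_) (fun m hlt i hi u hu hord ↦ ?_)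
  · -- odd depth `2m+1`: sign `w(E)`, no seed
    have h := KolyvaginLowerTwo.avoidance_of_kolyvaginSupply_intrinsic W Dt β ι τ L hρ2 hIQ h3 hodd hHe hT h37 hτ W.rootNumber hL1
      (hMr (2 * m)) (hMrL (2 * m)) ⊥
      (fun i u hi hu ↦ by
        obtain ⟨n, hn', hKol, d, hsub, hordc, hsign, hdisj⟩ := hOdd m hlt i u hi hu
        exact ⟨n, hn', hKol, d, hsub, hordc, hsign, by rwa [sup_bot_eq]⟩)
      i hi u hu hord
    obtain ⟨y, hPy, hyord, hyav⟩ := h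
    exact ⟨y, hPy, hyord, by rwa [sup_bot_eq] at hyav⟩
  · -- even depth `2m+2`: sign `−w(E)`, seed `⟨δ(P₀)⟩ = ⟨c_L(1)⟩`
    have h := KolyvaginLowerTwo.avoidance_of_kolyvaginSupply_intrinsic W Dt β ι τ L hρ2 hIQ h3 hodd hHe hT h37 hτ (-W.rootNumber) hL1
      (hMr (2 * m + 1)) (hMrL (2 * m + 1)) (zmultiples (kummerMapTorsion (W.baseChange K) ((2 ^ L : ℕ) : ℤ) hdiv P₀))
      (fun i u hi hu ↦ by
        obtain ⟨n, hn', hKol, d, hsub, hordc, hsign, hdisj⟩ := hEven m hlt i u hi hu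
        exact ⟨n, hn', hKol, d, hsub, hordc, hsign, by rwa [hc1] at hdisj⟩)
      i hi u hu hord
    exact h


/-! ## §2 (R0) discharged: the capstone modulo (KS) and `rank E(K) = 1` -/

/-- **gk2's STUB L CONCLUSION MODULO (KS) and `rank E(K) = 1` ONLY, without the image binders** — (R0) discharged by gk2-p2's image-free
`rankZero_side_of_rootNumber`; gk2-p2's `twinShaLadders_of_kolyvaginSuppliesAtTwo'` re-threaded (credit gk2-p2 g18).
[cite: McCallumLMS1991, §5 Prop. 5.2, Thm. 5.4 (p. 310)] [cite: GrossLMS1991, Thm. 1.3, Prop. 5.3, Prop. 5.4] -/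
theorem twinShaLadders_of_kolyvaginSuppliesAtTwo'
    (W : WeierstrassCurve ℚ) [W.IsElliptic] [W.IsGloballyMinimal] [NeZero (W.conductorNorm ℤ)] (hρ2 : W.HasSurjectiveModNGaloisRep 2)
    (hT : Odd W.tamagawaProduct) (K : Type) [Field K] [NumberField K] (hIQ : IsImaginaryQuadratic K)
    (hodd : Odd (NumberField.discr K)) (h3 : NumberField.discr K ≠ -3) (hHe : SatisfiesHeegnerHypothesis (W.conductorNorm ℤ) K)
    (h37 : prop37_2_reductionCongruence_inert (W.conductorNorm ℤ) W K)
    (Dt : ModularParametrizationData W (W.conductorNorm ℤ)) (β : ℤ) (ι : K →+* ℂ) (d₁ : KolyvaginHeegnerData Dt β ι 1)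
    (hy : ¬ IsOfFinAddOrder d₁.derivedPoint) (hrk1 : (W.baseChange K).mordellWeilRank = 1) (M₀ : ℕ)
    (hndiv : ¬ ∃ Q : (W.baseChange (ringClassField K ι 1)).toAffine.Point, ((2 ^ (M₀ + 1) : ℕ) : ℤ) • Q = d₁.derivedPoint)
    (Wd : WeierstrassCurve ℚ) [Wd.IsElliptic] (hTw : ∃ C : VariableChange ℚ, C • W.quadraticTwist (NumberField.discr K : ℚ) = Wd)
    (hKS : ∀ τ : K ≃ₐ[ℚ] K, τ ≠ 1 → ∃ (L R : ℕ) (Mr : ℕ → ℕ), M₀ + 1 ≤ L ∧ (∀ j, Mr (j + 1) ≤ Mr j) ∧ Mr 0 = M₀ ∧ Mr R = 0 ∧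
      (∀ m : ℕ, Mr (2 * m + 1) < Mr (2 * m) →
        ∀ (i : ℕ) (u : Fin i → galH1Torsion (W.baseChange K) ((2 ^ L : ℕ) : ℤ)), i ≤ 2 * m + 1 →
        (∀ j, u j ∈ selmerGroup (W.baseChange K) ((2 ^ L : ℕ) : ℤ) ∧
          conjAct W τ ((2 ^ L : ℕ) : ℤ) (u j) = W.rootNumber • u j) →
        ∃ (n : ℕ) (_ : Squarefree n)
          (_ : ∀ ℓ ∈ n.primeFactors, Zhang2014.IsKolyvaginPrime (W.conductorNorm ℤ) W K 2 ℓ ∧ L ≤ Zhang2014.kolyvaginIndex W 2 ℓ)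
          (d : KolyvaginHeegnerData Dt β ι n),
          (∀ ℓ ∈ n.primeFactors, ∀ e : KolyvaginHeegnerData Dt β ι (n / ℓ),
            ((2 ^ (L - Mr (2 * m)) : ℕ) : ℤ) • e.kolyvaginClass Nat.prime_two L = 0) ∧
          addOrderOf (d.kolyvaginClass Nat.prime_two L) = 2 ^ (L - Mr (2 * m + 1)) ∧
          -W.rootNumber * (-1) ^ n.primeFactors.card = W.rootNumber ∧
          Disjoint (zmultiples (((2 ^ (L - Mr (2 * m)) : ℕ) : ℤ) • d.kolyvaginClass Nat.prime_two L))
            (AddSubgroup.closure (Set.range u))) ∧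
      (∀ m : ℕ, Mr (2 * m + 2) < Mr (2 * m + 1) →
        ∀ (i : ℕ) (u : Fin i → galH1Torsion (W.baseChange K) ((2 ^ L : ℕ) : ℤ)), i ≤ 2 * m + 1 →
        (∀ j, u j ∈ selmerGroup (W.baseChange K) ((2 ^ L : ℕ) : ℤ) ∧
          conjAct W τ ((2 ^ L : ℕ) : ℤ) (u j) = (-W.rootNumber) • u j) →
        ∃ (n : ℕ) (_ : Squarefree n)
          (_ : ∀ ℓ ∈ n.primeFactors, Zhang2014.IsKolyvaginPrime (W.conductorNorm ℤ) W K 2 ℓ ∧ L ≤ Zhang2014.kolyvaginIndex W 2 ℓ)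
          (d : KolyvaginHeegnerData Dt β ι n),
          (∀ ℓ ∈ n.primeFactors, ∀ e : KolyvaginHeegnerData Dt β ι (n / ℓ),
            ((2 ^ (L - Mr (2 * m + 1)) : ℕ) : ℤ) • e.kolyvaginClass Nat.prime_two L = 0) ∧
          addOrderOf (d.kolyvaginClass Nat.prime_two L) = 2 ^ (L - Mr (2 * m + 2)) ∧
          -W.rootNumber * (-1) ^ n.primeFactors.card = -W.rootNumber ∧
          Disjoint (zmultiples (((2 ^ (L - Mr (2 * m + 1)) : ℕ) : ℤ) • d.kolyvaginClass Nat.prime_two L))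
            (AddSubgroup.closure (Set.range u) ⊔ zmultiples (d₁.kolyvaginClass Nat.prime_two L)))) :
    ∃ (T : ℕ) (M : ℕ → ℕ), (∀ j, M (j + 1) ≤ M j) ∧ M 0 = M₀ ∧ M (2 * T) = 0 ∧
      (∀ m < T, ∃ x : Fin (2 * m + 2) → W.galH1, (∀ i, resBaseChange W K (x i) ∈ (W.baseChange K).sha) ∧
        (∀ i, addOrderOf (x i) = 2 ^ (M (2 * m) - M (2 * m + 1))) ∧
        ∀ c : Fin (2 * m + 2) → ℤ, ∑ i, c i • x i = 0 → ∀ i, ((2 ^ (M (2 * m) - M (2 * m + 1)) : ℕ) : ℤ) ∣ c i) ∧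
      (∀ m < T, ∃ x : Fin (2 * m + 2) → Wd.galH1, (∀ i, resBaseChange Wd K (x i) ∈ (Wd.baseChange K).sha) ∧
        (∀ i, addOrderOf (x i) = 2 ^ (M (2 * m + 1) - M (2 * m + 2))) ∧
        ∀ c : Fin (2 * m + 2) → ℤ, ∑ i, c i • x i = 0 → ∀ i, ((2 ^ (M (2 * m + 1) - M (2 * m + 2)) : ℕ) : ℤ) ∣ c i) := by
  -- (R0) from `rank E(K) = 1`, the Heegner point over `P(1)` and `ρ̄_{E,2}` onto
  obtain ⟨Ph, hPh, hPhmap⟩ := AdditiveKoly.exists_isHeegnerPoint_map_eq_derivedPoint_one (W := W) (K := K) (Dt := Dt) (β := β)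
    (ι := ι) hIQ hHe d₁
  have hnt : ¬ IsOfFinAddOrder Ph := fun h ↦ hy (by
    rw [← hPhmap]
    exact AddMonoidHom.isOfFinAddOrder _ h)
  have hR0 := rankZero_side_of_rootNumber K W hIQ hHe hρ2 hrk1 hPh hnt hTw
  exact KolyvaginLowerTwo.twinShaLadders_of_kolyvaginSuppliesAtTwo W hρ2 hT K hIQ hodd h3 hHe h37 Dt β ι d₁ hrk1 M₀ hndiv Wd hTw hR0
    hKS

end Summit.BirchSwinnertonDyer.BirchSwinnertonDyer.Theorems.KolyvaginLowerTwo

end
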